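import Summits.NavierStokesRegularity.NavierStokesRegularity.Theorems.ExtremiserTransienceNearExtremalTransiencePerFlowMemberSelectionZoomInvariance
import Literature.Analysis.FluidPDE.HarmonicMeanValue
import Literature.Analysis.FluidPDE.HarmonicProbe
import Literature.Analysis.FluidPDE.LocalBiotSavartCalculus
import Literature.Analysis.FluidPDE.VorticityCalculus
import Literature.Analysis.FluidPDE.BiotSavartCurlPair
import Literature.Analysis.FluidPDE.FlatSwirlGauge
import Literature.Analysis.FluidPDE.KatoSymmetryCovariance
import Literature.Analysis.FluidPDE.LeiZhang2011Proofs
import HarnessLib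

/-!
# Route `ExtremiserTransience`, crux `NearExtremalTransiencePerFlow` (stmt-NavierStokesRegularity-26567) —
# LINE g11-α «Leray pincer» (ns-idea-5 g11), support lemma `StrongPointBudget`, part 1: THE WEIGHTED MEAN VALUE IDENTITY WITH DEFECT

`--supports stmt-NavierStokesRegularity-26567` (helper; prover seat ns-net-p2 g11).  The classical mean value property says
`∫ w(y) η(x₀ + y) dy = (∫ w) η(x₀)` for harmonic `η` and a radial weight `w` (tree: `integral_radial_mul_harmonic`, Gilbarg–Trudinger
Thm 2.1).  For a component `g = ⟪u, e⟫` of a DIVERGENCE-FREE field `u` the same computation leaves a DEFECT controlled by the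
vorticity `ω = curl u` alone, because `Δu = −curl ω` (`laplacian_eq_neg_curl_curl`) and the curl can be moved onto the radial primitive:
* `abs_integral_radial_mul_fderiv_inner_le` — the core identity with defect: with `∇P = w(y) y` (`exists_radial_primitive`), Green's first
  identity (`integral_inner_laplacian_add_eq_zero`) and `∫⟪curl ω, P e⟫ = ∫⟪ω, ∇P × e⟫` (`integral_inner_curl_eq_integral_inner_curl`,
  `curl_smul_const`) give `|∫ w(y) Dg(y)[y] dy| ≤ ‖e‖ ∫ |w(y)| ‖y‖ ‖ω(y)‖ dy`;
* `abs_integral_radial_mul_fderiv_inner_zoom_le` — the same at every scale/centre: `|∫ w(y) Dg(x₀ + s y)[y] dy| ≤ ‖e‖ ∫ |w| ‖y‖ ‖ω(x₀ + s y)‖`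
  (`s ≠ 0`; the zoomed field `u(x₀ + s ·)` is divergence free with curl `s ω(x₀ + s ·)`);
* `hasDerivAt_radialFamily` — `J(s) = ∫ w(y) g(x₀ + s y) dy` has `J'(s) = ∫ w(y) Dg(x₀ + s y)[y] dy` (differentiation under the
  integral sign, as in `integral_radial_mul_harmonic`), and `abs_sub_le_of_deriv_two_regimes` — the two-regime mean value estimate
  `|J 1 − J 0| ≤ δ K₁ + (1 − δ) K₂`;
* `integral_indicator_ball_comp_affine` — `∫ 1_{‖y‖<R} f(x₀ + s y) dy = s⁻³ ∫_{B(x₀, sR)} f`, and the elementary `two_mul_abs_mul_le`.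
Elementary real analysis on `ℝ³`; nothing about Navier–Stokes is used; no summit is proved by a line.
[cite: GilbargTrudinger2001, Thm 2.1 and (2.7)–(2.8)] [cite: MajdaBertozziCUP2002, §1.1 vector identities and Prop. 2.16]
-/

noncomputable section

open scoped Topology InnerProductSpace RealInnerProductSpace ENNReal ContDiff Laplacian
open MeasureTheory Filter Set Metric Function InnerProductSpace
open Literature.Analysis Literature.Analysis.FluidPDE

namespace Summit.NavierStokesRegularity.NavierStokesRegularity.Theorems

-- the problem directory repeats the summit name (`NavierStokesRegularity/NavierStokesRegularity`)
set_option linter.dupNamespace false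

namespace NearExtremalTransiencePerFlow.LerayPincer

section Core

variable {u : EuclideanSpace ℝ (Fin 3) → EuclideanSpace ℝ (Fin 3)} {w : EuclideanSpace ℝ (Fin 3) → ℝ}
  {e : EuclideanSpace ℝ (Fin 3)}

/-- The component `x ↦ ⟪u x, e⟫` of a `C²` divergence-free field has Laplacian `−⟪curl (curl u) x, e⟫`. [folklore] -/
theorem laplacian_inner_const_eq (hu : ContDiff ℝ 2 u) (hdiv : VectorCalculus.IsDivFree u) (e x : EuclideanSpace ℝ (Fin 3)) :
    (Δ (fun z => ⟪u z, e⟫_ℝ)) x = -⟪curl (curl u) x, e⟫_ℝ := by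
  have h := ContDiffAt.laplacian_CLM_comp_left (l := (innerSL ℝ e : EuclideanSpace ℝ (Fin 3) →L[ℝ] ℝ)) (hu.contDiffAt (x := x))
  have e1 : (fun z => ⟪u z, e⟫_ℝ) = (innerSL ℝ e : EuclideanSpace ℝ (Fin 3) →L[ℝ] ℝ) ∘ u := by
    funext z; simp [real_inner_comm]
  rw [e1, h, Function.comp_apply, laplacian_eq_neg_curl_curl hu hdiv x]
  simp [real_inner_comm]

/-- **Core identity with defect.**  For `u ∈ C²` divergence free, a unit-free direction `e`, and a continuous compactly supported
radial weight `w`, the radial first moment of `D⟪u, e⟫` is a vorticity integral: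
`|∫ w(y) D⟪u,e⟫(y)[y] dy| ≤ ‖e‖ ∫ |w(y)| ‖y‖ ‖curl u (y)‖ dy` (Green's identity with the radial primitive `P`, `Δ⟪u,e⟫ = −⟪curl ω, e⟫`,
and the curl moved onto `P e`: `curl (P e) = ∇P × e = w(y) y × e`). [folklore] -/
theorem abs_integral_radial_mul_fderiv_inner_le (hu : ContDiff ℝ 2 u) (hdiv : VectorCalculus.IsDivFree u)
    (hw : Continuous w) (hc : HasCompactSupport w) (hrad : ∀ x y, ‖x‖ = ‖y‖ → w x = w y) (e : EuclideanSpace ℝ (Fin 3)) :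
    |∫ y, w y * fderiv ℝ (fun z => ⟪u z, e⟫_ℝ) y y| ≤ ‖e‖ * ∫ y, |w y| * ‖y‖ * ‖curl u y‖ := by
  obtain ⟨P, hP1, hPc, hP⟩ := exists_radial_primitive hw hc hrad
  set g : EuclideanSpace ℝ (Fin 3) → ℝ := fun z => ⟪u z, e⟫_ℝ with hg
  have hg2 : ContDiff ℝ 2 g := (hu.inner ℝ contDiff_const)
  have hg1 : ContDiff ℝ 1 g := hg2.of_le one_le_two
  set b := stdOrthonormalBasis ℝ (EuclideanSpace ℝ (Fin 3))
  -- Green's first identity: `∫ Δg P + Σᵢ ∫ ∂ᵢg ∂ᵢP = 0`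
  have green := FluidPDE.integral_inner_laplacian_add_eq_zero b hg2 hP1 (Or.inr hPc)
  have hfd : ∀ y, fderiv ℝ P y = w y • (innerSL ℝ y : EuclideanSpace ℝ (Fin 3) →L[ℝ] ℝ) := fun y => (hP y).fderiv
  -- the sum over the basis is the radial moment
  have key : ∀ y, w y * fderiv ℝ g y y = ∑ i, ⟪fderiv ℝ g y (b i), fderiv ℝ P y (b i)⟫_ℝ := fun y => by
    have hs : fderiv ℝ g y y = ∑ i, ⟪b i, y⟫_ℝ * fderiv ℝ g y (b i) := by
      have : fderiv ℝ g y y = fderiv ℝ g y (∑ i, ⟪b i, y⟫_ℝ • b i) := by rw [b.sum_repr' y]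
      rw [this, map_sum]
      simp only [map_smul, smul_eq_mul]
    rw [hs, Finset.mul_sum]
    refine Finset.sum_congr rfl fun i _ => ?_
    rw [hfd y]
    simp only [_root_.FunLike.coe_smul, Pi.smul_apply, innerSL_apply_apply, smul_eq_mul]
    simp only [RCLike.inner_apply, conj_trivial]
    rw [real_inner_comm]
    ring
  have hint : ∀ i, Integrable (fun y => ⟪fderiv ℝ g y (b i), fderiv ℝ P y (b i)⟫_ℝ) (volume : Measure (EuclideanSpace ℝ (Fin 3))) :=
    fun i => by
    refine Continuous.integrable_of_hasCompactSupport ?_ ?_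
    · exact (((hg1.continuous_fderiv one_ne_zero).clm_apply continuous_const)).inner
        ((hP1.continuous_fderiv one_ne_zero).clm_apply continuous_const)
    · exact (hPc.fderiv_apply (𝕜 := ℝ) (b i)).mono fun y hy => by
        contrapose! hy
        simp only [mem_support, not_not] at hy
        simp [hy]
  have hsum : ∫ y, w y * fderiv ℝ g y y = ∑ i, ∫ y, ⟪fderiv ℝ g y (b i), fderiv ℝ P y (b i)⟫_ℝ := by
    simp_rw [key]; rw [integral_finsetSum _ fun i _ => hint i]
  -- so `∫ w Dg[y] = -∫ Δg · P = ∫ ⟪curl curl u, e⟫ P`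
  have hΔ : ∀ y, (Δ g) y = -⟪curl (curl u) y, e⟫_ℝ := fun y => laplacian_inner_const_eq hu hdiv e y
  have h1 : ∫ y, w y * fderiv ℝ g y y = ∫ y, ⟪curl (curl u) y, e⟫_ℝ * P y := by
    have e2 : (∫ y, ⟪(Δ g) y, P y⟫_ℝ) = -∫ y, ⟪curl (curl u) y, e⟫_ℝ * P y := by
      rw [← integral_neg]
      refine integral_congr_ae (Eventually.of_forall fun y => ?_)
      simp only [hΔ y, RCLike.inner_apply, conj_trivial]
      ring
    rw [hsum]; linarith [green, e2]
  -- move the curl: `∫ ⟪curl (curl u), P e⟫ = ∫ ⟪curl u, curl (P e)⟫ = ∫ ⟪curl u, (w y • y) × e⟫`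
  have hΨ : ContDiff ℝ 1 (fun y => P y • e) := hP1.smul contDiff_const
  have hΨc : HasCompactSupport (fun y => P y • e) := hPc.smul_right
  have hcu : ContDiff ℝ 1 (curl u) := contDiff_curl (n := 1) (by exact_mod_cast hu)
  have h2 : ∫ y, ⟪curl (curl u) y, e⟫_ℝ * P y = ∫ y, ⟪curl u y, cross (w y • y) e⟫_ℝ := by
    have e3 : ∀ y, ⟪curl (curl u) y, e⟫_ℝ * P y = ⟪curl (curl u) y, P y • e⟫_ℝ := fun y => by
      rw [real_inner_smul_right]; ring
    simp_rw [e3]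
    rw [integral_inner_curl_eq_integral_inner_curl hcu hΨ hΨc]
    refine integral_congr_ae (Eventually.of_forall fun y => ?_)
    have hgrad : gradient P y = w y • y := by
      rw [gradient, (hP y).fderiv, map_smul]
      congr 1
      apply (InnerProductSpace.toDual ℝ (EuclideanSpace ℝ (Fin 3))).injective
      rw [LinearIsometryEquiv.apply_symm_apply]
      ext z
      rw [InnerProductSpace.toDual_apply_apply, innerSL_apply_apply]
    show ⟪curl u y, curl (fun y => P y • e) y⟫_ℝ = ⟪curl u y, cross (w y • y) e⟫_ℝ
    rw [curl_smul_const (hP1.differentiable one_ne_zero y) e, hgrad]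
  rw [h1, h2]
  -- pointwise bound and integration
  calc |∫ y, ⟪curl u y, cross (w y • y) e⟫_ℝ| ≤ ∫ y, |⟪curl u y, cross (w y • y) e⟫_ℝ| := abs_integral_le_integral_abs
    _ ≤ ∫ y, ‖e‖ * (|w y| * ‖y‖ * ‖curl u y‖) := by
        refine integral_mono_of_nonneg (Eventually.of_forall fun y => abs_nonneg _) ?_ (Eventually.of_forall fun y => ?_)
        · exact ((((hw.abs).mul continuous_norm).mul (continuous_curl (hu.of_le one_le_two)).norm).const_mul ‖e‖
            ).integrable_of_hasCompactSupport (((hc.abs).mul_right).mul_right).mul_left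
        · calc |⟪curl u y, cross (w y • y) e⟫_ℝ| ≤ ‖curl u y‖ * ‖cross (w y • y) e‖ := abs_real_inner_le_norm _ _
            _ ≤ ‖curl u y‖ * (‖w y • y‖ * ‖e‖) := mul_le_mul_of_nonneg_left (norm_cross_le_norm_mul_norm _ _) (norm_nonneg _)
            _ = ‖e‖ * (|w y| * ‖y‖ * ‖curl u y‖) := by rw [norm_smul, Real.norm_eq_abs]; ring
    _ = ‖e‖ * ∫ y, |w y| * ‖y‖ * ‖curl u y‖ := integral_const_mul _ _

/-- **Core identity with defect, rescaled and recentred.**  For `s ≠ 0`: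
`|∫ w(y) D⟪u,e⟫(x₀ + s y)[y] dy| ≤ ‖e‖ ∫ |w(y)| ‖y‖ ‖curl u (x₀ + s y)‖ dy` (the core identity for the zoomed field
`y ↦ u (x₀ + s y)`, whose curl is `s • curl u (x₀ + s y)` and whose component derivative along `y` is `s` times the original). -/
theorem abs_integral_radial_mul_fderiv_inner_zoom_le (hu : ContDiff ℝ (⊤ : ℕ∞) u) (hdiv : VectorCalculus.IsDivFree u)
    (hw : Continuous w) (hc : HasCompactSupport w) (hrad : ∀ x y, ‖x‖ = ‖y‖ → w x = w y)
    (e x₀ : EuclideanSpace ℝ (Fin 3)) {s : ℝ} (hs : s ≠ 0) :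
    |∫ y, w y * fderiv ℝ (fun z => ⟪u z, e⟫_ℝ) (x₀ + s • y) y| ≤ ‖e‖ * ∫ y, |w y| * ‖y‖ * ‖curl u (x₀ + s • y)‖ := by
  -- the zoomed field `us = u (x₀ + s ·)`: smooth, divergence free, `curl us = s • (curl u)(x₀ + s ·)`
  set ut : EuclideanSpace ℝ (Fin 3) → EuclideanSpace ℝ (Fin 3) := fun z => u (z + x₀) with hut
  set us : EuclideanSpace ℝ (Fin 3) → EuclideanSpace ℝ (Fin 3) := fun z => u (x₀ + s • z) with hus
  have e_us : us = fun z => (1 : ℝ) • ut (s • z) := by funext z; simp only [hus, hut, one_smul, add_comm]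
  have hutT : ContDiff ℝ (⊤ : ℕ∞) ut := hu.comp (contDiff_id.add contDiff_const)
  have husT : ContDiff ℝ (⊤ : ℕ∞) us := hu.comp (contDiff_const.add (contDiff_const_smul s))
  have husdiv : VectorCalculus.IsDivFree us := by
    have h1 : VectorCalculus.IsDivFree ut := hdiv.comp_add_right x₀
    have h2 : VectorCalculus.IsDivFree (fun z => ut (s • z)) := h1.comp_smul s
    have e2 : us = fun z => ut (s • z) := by rw [e_us]; funext z; rw [one_smul]
    rw [e2]; exact h2
  have core := abs_integral_radial_mul_fderiv_inner_le (husT.of_le (by norm_cast)) husdiv hw hc hrad e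
  -- identify the two integrands
  set g : EuclideanSpace ℝ (Fin 3) → ℝ := fun z => ⟪u z, e⟫_ℝ with hg
  have hg1 : ContDiff ℝ 1 g := (hu.of_le (by norm_cast)).inner ℝ contDiff_const
  have hD : ∀ y, fderiv ℝ (fun z => ⟪us z, e⟫_ℝ) y y = s * fderiv ℝ g (x₀ + s • y) y := by
    intro y
    have hA : HasFDerivAt (fun z : EuclideanSpace ℝ (Fin 3) => x₀ + s • z) (s • ContinuousLinearMap.id ℝ (EuclideanSpace ℝ (Fin 3))) y :=
      ((hasFDerivAt_id y).const_smul s).const_add x₀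
    have hG : HasFDerivAt g (fderiv ℝ g (x₀ + s • y)) (x₀ + s • y) := ((hg1.differentiable one_ne_zero) _).hasFDerivAt
    have hcomp := hG.comp y hA
    have e1 : (fun z => ⟪us z, e⟫_ℝ) = g ∘ fun z => x₀ + s • z := by funext z; simp [hg, hus]
    rw [e1, hcomp.fderiv, ContinuousLinearMap.comp_apply, FunLike.coe_smul, Pi.smul_apply,
      ContinuousLinearMap.id_apply, map_smul, smul_eq_mul]
  have hC : ∀ y, curl us y = s • curl u (x₀ + s • y) := fun y => by
    rw [e_us, curl_smul_comp_smul, one_mul, hut, curl_comp_add_const, add_comm]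
  have eL : ∫ y, w y * fderiv ℝ (fun z => ⟪us z, e⟫_ℝ) y y = s * ∫ y, w y * fderiv ℝ g (x₀ + s • y) y := by
    rw [← integral_const_mul]; refine integral_congr_ae (Eventually.of_forall fun y => ?_)
    show w y * fderiv ℝ (fun z => ⟪us z, e⟫_ℝ) y y = s * (w y * fderiv ℝ g (x₀ + s • y) y)
    rw [hD]; ring
  have eR : ∫ y, |w y| * ‖y‖ * ‖curl us y‖ = |s| * ∫ y, |w y| * ‖y‖ * ‖curl u (x₀ + s • y)‖ := by
    rw [← integral_const_mul]; refine integral_congr_ae (Eventually.of_forall fun y => ?_)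
    show |w y| * ‖y‖ * ‖curl us y‖ = |s| * (|w y| * ‖y‖ * ‖curl u (x₀ + s • y)‖)
    rw [hC, norm_smul, Real.norm_eq_abs]; ring
  rw [eL, eR, abs_mul] at core
  have hs' : 0 < |s| := abs_pos.2 hs
  have : |s| * |∫ y, w y * fderiv ℝ g (x₀ + s • y) y| ≤ |s| * (‖e‖ * ∫ y, |w y| * ‖y‖ * ‖curl u (x₀ + s • y)‖) := by
    calc _ ≤ ‖e‖ * (|s| * ∫ y, |w y| * ‖y‖ * ‖curl u (x₀ + s • y)‖) := core
      _ = _ := by ring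
  exact le_of_mul_le_mul_left this hs'

end Core

section Family

variable {g w : EuclideanSpace ℝ (Fin 3) → ℝ} {x₀ : EuclideanSpace ℝ (Fin 3)} {ρ : ℝ}

/-- Differentiation under the integral sign: `J'(s) = ∫ w(y) Dg(x₀ + s y)[y] dy` for `g ∈ C¹` and a continuous weight supported
in `‖y‖ < ρ` (the pattern of `integral_radial_mul_harmonic`). [folklore] -/
theorem hasDerivAt_radialFamily (hg : ContDiff ℝ 1 g) (hw : Continuous w) (hc : HasCompactSupport w) (hρ : 0 < ρ)
    (hw0 : ∀ y, ρ ≤ ‖y‖ → w y = 0) (x₀ : EuclideanSpace ℝ (Fin 3)) (s : ℝ) :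
    HasDerivAt (fun s' => ∫ y, w y * g (x₀ + s' • y)) (∫ y, w y * fderiv ℝ g (x₀ + s • y) y) s := by
  have hgc : Continuous g := hg.continuous
  have hDgc : Continuous (fderiv ℝ g) := hg.continuous_fderiv one_ne_zero
  have hgd : ∀ z, HasFDerivAt g (fderiv ℝ g z) z := fun z => (hg.differentiable one_ne_zero z).hasFDerivAt
  obtain ⟨C, hC⟩ := (isCompact_closedBall x₀ ((|s| + 1) * ρ)).exists_bound_of_continuousOn hDgc.continuousOn
  have hC0 : 0 ≤ C := le_trans (norm_nonneg _) (hC x₀ (mem_closedBall_self (by positivity)))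
  have haff : ∀ s' : ℝ, Continuous fun y : EuclideanSpace ℝ (Fin 3) => x₀ + s' • y := fun s' =>
    continuous_const.add (continuous_id.const_smul s')
  have hFc : ∀ s', Continuous fun y => w y * g (x₀ + s' • y) := fun s' => hw.mul (hgc.comp (haff s'))
  have hF_meas : ∀ s', AEStronglyMeasurable (fun y => w y * g (x₀ + s' • y)) (volume : Measure (EuclideanSpace ℝ (Fin 3))) :=
    fun s' => (hFc s').aestronglyMeasurable
  have hF_int : Integrable (fun y => w y * g (x₀ + s • y)) (volume : Measure (EuclideanSpace ℝ (Fin 3))) :=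
    (hFc s).integrable_of_hasCompactSupport hc.mul_right
  have hF'c : Continuous fun y => w y * fderiv ℝ g (x₀ + s • y) y := hw.mul ((hDgc.comp (haff s)).clm_apply continuous_id)
  have hF'_meas : AEStronglyMeasurable (fun y => w y * fderiv ℝ g (x₀ + s • y) y) (volume : Measure (EuclideanSpace ℝ (Fin 3))) :=
    hF'c.aestronglyMeasurable
  have h_bound : ∀ᵐ y ∂(volume : Measure (EuclideanSpace ℝ (Fin 3))), ∀ s' ∈ ball s 1,
      ‖w y * fderiv ℝ g (x₀ + s' • y) y‖ ≤ C * ρ * |w y| := by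
    refine Eventually.of_forall fun y s' hs' => ?_
    rcases le_or_gt ρ ‖y‖ with hy | hy
    · simp [hw0 y hy]
    · have hmem : x₀ + s' • y ∈ closedBall x₀ ((|s| + 1) * ρ) := by
        rw [mem_closedBall, dist_eq_norm, add_sub_cancel_left, norm_smul, Real.norm_eq_abs]
        have hs'1 : |s'| ≤ |s| + 1 := by
          rw [mem_ball, Real.dist_eq] at hs'
          have := abs_sub_abs_le_abs_sub s' s
          linarith
        exact mul_le_mul hs'1 hy.le (norm_nonneg _) (by positivity)
      rw [norm_mul, Real.norm_eq_abs]
      calc |w y| * ‖fderiv ℝ g (x₀ + s' • y) y‖ ≤ |w y| * (C * ρ) := by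
            refine mul_le_mul_of_nonneg_left ?_ (abs_nonneg _)
            calc ‖fderiv ℝ g (x₀ + s' • y) y‖ ≤ ‖fderiv ℝ g (x₀ + s' • y)‖ * ‖y‖ := ContinuousLinearMap.le_opNorm _ _
              _ ≤ C * ρ := mul_le_mul (hC _ hmem) hy.le (norm_nonneg _) hC0
        _ = C * ρ * |w y| := by ring
  have h_diff : ∀ᵐ y ∂(volume : Measure (EuclideanSpace ℝ (Fin 3))), ∀ s' ∈ ball s 1,
      HasDerivAt (fun r => w y * g (x₀ + r • y)) (w y * fderiv ℝ g (x₀ + s' • y) y) s' := by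
    refine Eventually.of_forall fun y s' _ => ?_
    have h1 : HasDerivAt (fun r : ℝ => x₀ + r • y) y s' := by
      simpa using ((hasDerivAt_id s').smul_const y).const_add x₀
    exact ((hgd (x₀ + s' • y)).comp_hasDerivAt s' h1).const_mul (w y)
  exact (hasDerivAt_integral_of_dominated_loc_of_deriv_le (ball_mem_nhds s one_pos)
    (Eventually.of_forall hF_meas) hF_int hF'_meas h_bound
    ((hw.abs.integrable_of_hasCompactSupport hc.abs).const_mul (C * ρ)) h_diff).2

/-- Two-regime mean value estimate: if `|J'| ≤ K₁` on `[0, δ]` and `|J'| ≤ K₂` on `[δ, 1]` then `|J 1 − J 0| ≤ δ K₁ + (1 − δ) K₂`. -/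
theorem abs_sub_le_of_deriv_two_regimes {J J' : ℝ → ℝ} (hJ : ∀ s, HasDerivAt J (J' s) s) {δ K₁ K₂ : ℝ} (hδ0 : 0 ≤ δ)
    (hδ1 : δ ≤ 1) (h1 : ∀ s ∈ Set.Icc 0 δ, |J' s| ≤ K₁) (h2 : ∀ s ∈ Set.Icc δ 1, |J' s| ≤ K₂) :
    |J 1 - J 0| ≤ δ * K₁ + (1 - δ) * K₂ := by
  have hA : ‖J δ - J 0‖ ≤ K₁ * (δ - 0) :=
    norm_image_sub_le_of_norm_deriv_le_segment' (fun s _ => (hJ s).hasDerivWithinAt)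
      (fun s hs => by rw [Real.norm_eq_abs]; exact h1 s ⟨hs.1, hs.2.le⟩) δ (Set.right_mem_Icc.2 hδ0)
  have hB : ‖J 1 - J δ‖ ≤ K₂ * (1 - δ) :=
    norm_image_sub_le_of_norm_deriv_le_segment' (fun s _ => (hJ s).hasDerivWithinAt)
      (fun s hs => by rw [Real.norm_eq_abs]; exact h2 s ⟨hs.1, hs.2.le⟩) 1 (Set.right_mem_Icc.2 hδ1)
  rw [Real.norm_eq_abs] at hA hB
  calc |J 1 - J 0| = |(J 1 - J δ) + (J δ - J 0)| := by ring_nf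
    _ ≤ |J 1 - J δ| + |J δ - J 0| := abs_add_le _ _
    _ ≤ K₂ * (1 - δ) + K₁ * (δ - 0) := add_le_add hB hA
    _ = δ * K₁ + (1 - δ) * K₂ := by ring

end Family

section Tools

open FluidPDE

/-- Elementary: `2|a b| ≤ α a² + b²/α` for `α > 0`. -/
theorem two_mul_abs_mul_le {a b α : ℝ} (hα : 0 < α) : 2 * |a * b| ≤ α * a ^ 2 + b ^ 2 / α := by
  rw [abs_mul]
  have h : α * (2 * (|a| * |b|)) ≤ α * (α * a ^ 2 + b ^ 2 / α) := by
    have e : α * (α * a ^ 2 + b ^ 2 / α) = α ^ 2 * a ^ 2 + b ^ 2 := by field_simp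
    rw [e]; nlinarith [sq_nonneg (α * |a| - |b|), sq_abs a, sq_abs b]
  exact le_of_mul_le_mul_left h hα

/-- Change of variables for the indicator of a ball under `y ↦ x₀ + s y` (`s > 0`):
`∫ 1_{‖y‖<R}(y) f(x₀ + s y) dy = (s³)⁻¹ ∫_{B(x₀, sR)} f`. -/
theorem integral_indicator_ball_comp_affine {s R : ℝ} (hs : 0 < s) (x₀ : EuclideanSpace ℝ (Fin 3))
    (f : EuclideanSpace ℝ (Fin 3) → ℝ) :
    ∫ y, (Metric.ball (0 : EuclideanSpace ℝ (Fin 3)) R).indicator (fun y => f (x₀ + s • y)) y =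
      (s ^ 3)⁻¹ * ∫ z in Metric.ball x₀ (s * R), f z := by
  have hpre : (fun y : EuclideanSpace ℝ (Fin 3) => x₀ + s • y) ⁻¹' Metric.ball x₀ (s * R) = Metric.ball 0 R := by
    rw [space_affine_preimage_ball hs]
    congr 1
    · simp
    · field_simp
  have h1 : (fun y => (Metric.ball (0 : EuclideanSpace ℝ (Fin 3)) R).indicator (fun y => f (x₀ + s • y)) y) =
      fun y => (Metric.ball x₀ (s * R)).indicator f (x₀ + s • y) := by
    funext y
    rw [← hpre, ← Set.indicator_comp_right]
    rfl
  rw [h1, integral_comp_space_affine hs x₀ ((Metric.ball x₀ (s * R)).indicator f), finrank_euclideanSpace_fin, smul_eq_mul,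
    integral_indicator measurableSet_ball]

end Tools

end NearExtremalTransiencePerFlow.LerayPincer

end Summit.NavierStokesRegularity.NavierStokesRegularity.Theorems

end
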